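import Summits.HodgeConjecture.HodgeConjecture.Theorems.F0P3ClassificationReadingV8
import HarnessLib

/-!
# `F0P3InnerFormClassificationV8` (T5-D, edition V8): the HEAD `shape_of_T5` — a pinned classification kit with the laws yields the guarded letters' shape of Thm. 14.6.4
# at its frame — and the frame-universal composition `shapeGuarded_of_T5` over a named `KitFamily`, feeding ★ B0 `letters_guarded_of_shape` BY NAME

Theorems rendering (F0P3-plan RULINGS (V9)(b)∕(V12)∕(V41)∕(V43), F0P3-p03) of the T5 statement layer = dossier line
`Cruxes/H413/Lines/F0_T5InnerFormClassification.lean` (v8 rf 3639e4bbb2677e64), split by topic into ★-importable modules (Theorems never import Lines):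
(A) ★ `F0P3ClassificationKitV6` — frame, e.v.p. germs, the kit, pins (§0–§1.2 of the dossier, UNCHANGED at this edition, NOT re-filed; namespace `…V6`);
(B) `F0P3ClassificationLawsV8` — the named laws, their `.mono`, `structure Laws`, over the reducible alias `…V8.ClassificationKit := …V6.ClassificationKit`;
(C) `F0P3ClassificationEngineV8` — §1.4 the intermediate statements (14.6.2) ∕ coefficient formula and §2 the integrator's own mathematics, PROVED;
(R) `F0P3ClassificationReadingV8` — `|E| ≤ 1` glue and the coefficient reading by fibre grouping (v7 §3); (D) `F0P3InnerFormClassificationV8` — the head `shape_of_T5`,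
the kit-family composition `shapeGuarded_of_T5`.  EDITION V8 (namespace suffix `V8`; supersedes the V6 chain ★ p821941∕p822130∕p822263∕p822609 as the edition of record).
Declarations and proofs are BYTE-IDENTICAL to the dossier text (except the type-preserving header spellings marked `dedup.landed` below); only module docstrings, the namespace name, the kit alias + `open`s of the ★ kit edition,
a few one-line docstrings (Theorems lint) and the re-emitted `variable` blocks differ.  No `sorry`, no named fact, no instance, no notation.

THIS MODULE: §4 `shape_of_T5`, §5 `KitFamily`, `KitFamily.IsPinned`, `KitFamily.Laws`, `shapeGuarded_of_T5` (default heartbeats), consumer checks.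
HONEST LABEL: HC_CM is proved only modulo the printed citations until rung 0 closes.
-/

attribute [local instance 100] LieRing.ofAssociativeRing

/-! ## v7 (2026-08-31, RULING (V43) — the BOOKS PASS; pen F0P3-plan (g5); hunk list = B-p08 (g20) consumption census `CENSUS-T5v6-law-consumption.B-p08g20.md` c7c5d389)
(h-a) GUARDS: the laws (L3′) `Routing` and (L7″) `LocalIsotypyFin` are consumed by the head ONLY at its own cotangent-type, `Kc`-trivial `P` (census (A): F:1120, F:1147),
so both now carry the leading antecedents `IsCot … P → KcTrivial … P →` — at 𝔠₀ (L7″) is then the in-house ★ p822835 `localIsotypyFin₀_of_isCot` (no «AFA» letter) and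
(L3′) follows a fortiori from the unguarded ★ letter `CohClassRouting` (p01 (g8)).  (h-b) NO DETERMINATION LAW: the fields `classEq` (unused) and `flathDet` (with the
derived (L7′) `ClassDet`, `classDet_of_pins`) are DELETED — the coefficient reading no longer re-indexes the class side of (14.6.2) by an INJECTIVE coordinate map but
GROUPS it by the fibres of `κ : c ↦ coordS S c` (`HasSum.sigma`; B-p08 (g20) ★ p823015 `coefficientFormula_of_laws_grouped`, ported here as
`ClassificationKit.mult_eq_one_of_laws_grouped` ∕ `ClassificationKit.coefficientFormula_of_laws_grouped`): every fibre is finite (a unitary coordinate is SEEN by a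
test function, `LinIndepS`; summable terms bounded away from `0`), `m(x) := Σ_{κ c = x, m(c) ≥ 1} m(c)` equals `E_ξ(x)` by (L2), and `|E_ξ| ≤ 1` forces `m(c) = 1`
for every class of positive multiplicity — Rogawski's own reading of `m(π) = 1` (p. 239 l. 1–4), with NO Flath uniqueness [Flath1979 Thm. 3 is no longer cited as a
law].  `CoefficientFormula` accordingly speaks of classes with `1 ≤ mult c` (the head's `cl P` has `mult = m(P) ≥ 1` by pin (i) + ★ `one_le_multiplicity`).
`IsPinned`, `KitFamily.IsPinned`, the head STATEMENT `shapeGuarded_of_T5` and every other law text are BYTE-UNCHANGED; `Laws` has two fields fewer.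
BOOKS: −1 («AFA» leaves the closer's ledger), −1 ((L7-det) gone: no letter, no F1b∕ARCH consumption).  HONEST LABEL: HC_CM is proved only modulo the printed
citations until rung 0 closes. -/

/-! ## v8 (2026-08-31, RULING (V44) on REF1 (g6) R-28 — THE LEVEL PASS; pen F0P3-plan (g5))
R-28: the level `K_v := cmLocalIntegralLevel L 3 H v` of the frame is hyperspecial ∕ Gelfand only for ALL BUT FINITELY MANY `v` (★ `HyperspecialGelfandPair` is a
COFINITE statement; ★ `UnitaryGroupHyperspecialHecke.eventually_isHyperspecialAt`), so an `S`-indexed LETTER asserted at an `S` missing a bad place is not print-true —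
sharpest witness: the `= 0` branch of `Factorisation` (a class ramified at a bad `v ∉ S` may have `dim π′_v^{K_v} ≥ 2`, and `Tr π′(f′_S ⊗ 1^S) ≠ 0`).  Rogawski's `S` always
contains `S₀ ⊇` {places where `E∕F`, `H` or the characters ramify} [Rogawski1990 §14.2 p. 228 l. 1; §4.9].  REPAIR (variant (α″) of REF1's (α), NO new kit socket): the laws
carry ONE finite set per frame — `structure Laws (μω) (hμu) (S₀ : Finset (Places L))`, `KitFamily.Laws 𝔎 := ∀ frame …, ∃ S₀, (𝔎 frame …).Laws μω hμu S₀` — and the eight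
`S`-indexed letter laws `Factorisation`, `MatchingS`, `TransferS`, `HatBounded`, `UnrStarAlgebra`, `UnitaryPacket`, `APacketSpectral`, `LocalExpansion` (with the derived
`Separation`, `PerClassIdentity`, `CoefficientFormula`) take `(S₀)` and read `∀ S, S₀ ⊆ S → ‹v7 body›`; each has a `.mono` (enlarging `S₀`), and so has `Laws`, so that
consumers UNION the witnesses of their letters.  UNGUARDED (print-true at every `S`): `TraceIdentity` (no `S`), `SpectralSideGp` (T1 pins), `LinIndepS` (Prop. 13.8.1),
`UnitaryCoord` (in-house), `HatInjective` (pins) and every `P`∕`ξ`-archimedean law.  The engine's core takes `S := S₁ ∪ ram ξ ∪ ramCls (cl P) ∪ S₀`.  The kit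
STRUCTURE, the pins `IsPinned`, `KitFamily`, `KitFamily.IsPinned`, the `Laws` FIELD NAMES and the head STATEMENT `shapeGuarded_of_T5` are BYTE-UNCHANGED (no `S`
occurs in a conclusion).  BOOKS: 0.  HONEST LABEL: HC_CM is proved only modulo the printed citations until rung 0 closes. -/

set_option autoImplicit false
set_option linter.dupNamespace false

-- Gate lint `dedup.landed` (header-text keyed): theorems whose header text coincides with a landed edition (v3.1 ∕ V5 ∕ V6 ∕ V7-B∕C) are written with
-- ONE binder's dot-notation expanded ∕ a numeral ascribed ∕ `≠` spelled `¬ … = …` — elaborated statements unchanged (F0P3-p03 (g7), 2026-08-31).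

noncomputable section

open NumberField IsDedekindDomain MeasureTheory
open scoped Matrix ComplexOrder BigOperators Classical

namespace Summit.HodgeConjecture.HodgeConjecture.Cruxes.H413.F0P3InnerFormClassificationV8

open Literature.NumberTheory.Rogawski1990 Literature.NumberTheory.GaloisRepresentations
open Literature.NumberTheory.Automorphic Literature.NumberTheory.Automorphic.UnitaryGroup
open Literature.NumberTheory.Automorphic.UnitaryGroup.CotangentForms
open Literature.RepresentationTheory.BorelWallach2000
open Literature.RepresentationTheory.KonnoKonno2007
open Summit.HodgeConjecture.HodgeConjecture.Cruxes.H413.F0P3InnerFormClassificationV6   -- ★ F0P3ClassificationKitV6: §0 frame abbreviations, §1 `Sockets`, the kit structure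
open Summit.HodgeConjecture.HodgeConjecture.Cruxes.H413.F0P3InnerFormClassificationV6.ClassificationKit   -- ★ §1.1 derived notation (`coordS`, `Adm`, `memberCoeff`, `expansion`), §1.2 `IsPinned`

/-! ## §4 THE HEAD — `∀ frame, pinned kit with laws ⇒ (C1♮) ∧ (C2♯) ∧ (C3♯)` at that frame, KERNEL-CHECKED; CONCLUSION KIT-FREE -/

/-- **THE HEAD OF T5 at one frame** (v4): for a PINNED classification kit satisfying the laws, and for `P` of COTANGENT TYPE at `ι` (RULING (V30)) that is
`Kc`-TRIVIAL (RULING (V31); ★ for holomorphic-cotangent `P`, `kcTrivial_of_isHolCotangentAt`), the guarded multiplicity bound (C1♮), print's membership WITH THE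
ARCHIMEDEAN PIN (C2♯) — `ξ_{ι′}` of cohomological type for trivial coefficients at EVERY complex embedding `ι′` w.r.t. `μω`'s parameter (F0P2's ★ `XiArchPinned`
minus the `μω`-side conjuncts, which F0P2 supplies) — and the one-`ξ`-per-token sign form (C3♯) of Thm. 14.6.4 hold; the ★ consumers (p04 (g6) B0
`letters_guarded_of_shape`, ★ p814530∕p814159, F0P2's S2♯) take them in ED. 2 (cotangent-guarded binders).
[cite: Rogawski1990, §14.6 Thm. 14.6.4 pp. 236–239; §13.7 p. 206; §15.3 ¶1; Prop. 15.2.1] -/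
theorem shape_of_T5 {L : Type} [Field L] [NumberField L] [IsCMField L] (H : Matrix (Fin 3) (Fin 3) L) (ι : L →+* ℂ) (T : GL (Fin 3) ℂ)
    (hT : (T : Matrix (Fin 3) (Fin 3) ℂ)ᴴ * H.map ι * (T : Matrix (Fin 3) (Fin 3) ℂ) = Literature.Geometry.ComplexHyperbolic.BallModel.J)
    (μ : Measure (Gp L H).automorphicQuotient) [(Gp L H).IsAutomorphicMeasure μ] (μω : HeckeCharacter L) (hμu : μω.IsUnitary)
    (𝔠 : ClassificationKit L H ι T hT μ) (hpin : 𝔠.IsPinned) {S₀ : Finset (Places L)} (hl : 𝔠.Laws μω hμu S₀)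
    -- the coefficient reading (Z10, proved below from the laws via (14.6.2) = Z2); REF1 R-17: the redundant `(14.6.2)` binder of v3.1 is dropped
    (hZ10 : 𝔠.CoefficientFormula S₀) :
    (∀ (P : DiscreteAutomorphicRep (Gp L H) μ),
        IsCot L H ι T hT μ P → KcTrivial L H ι T hT μ P → ∀
        (M : Type) [AddCommGroup M] [Module ℂ M]
        (σK : Representation ℂ (uFormGroup (Fin 2) (Fin 1)).maximalCompact M) (σ𝔤 : (uFormGroup (Fin 2) (Fin 1)).lie →ₗ⁅ℝ⁆ Module.End ℂ M)
        (hM : IsGKModule (uFormGroup (Fin 2) (Fin 1)) σK σ𝔤), IsIrreducibleGK σK σ𝔤 →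
        HasToken L H ι T hT μ P M σK σ𝔤 →
        ∀ δ : ℤ, (δ = 1 ∨ δ = -1) → upqTypeClasses σK σ𝔤 hM.ad_compat 1 δ ≠ ⊥ →
          ((Gp L H).rightRegular μ).multiplicity P.space.toContRep ≤ 1) ∧
    (∀ (P : DiscreteAutomorphicRep (Gp L H) μ),
        IsCot L H ι T hT μ P → KcTrivial L H ι T hT μ P → ∀
        (M : Type) [AddCommGroup M] [Module ℂ M]
        (σK : Representation ℂ (uFormGroup (Fin 2) (Fin 1)).maximalCompact M) (σ𝔤 : (uFormGroup (Fin 2) (Fin 1)).lie →ₗ⁅ℝ⁆ Module.End ℂ M)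
        (hM : IsGKModule (uFormGroup (Fin 2) (Fin 1)) σK σ𝔤), IsIrreducibleGK σK σ𝔤 →
        HasToken L H ι T hT μ P M σK σ𝔤 →
        ∀ δ : ℤ, (δ = 1 ∨ δ = -1) → upqTypeClasses σK σ𝔤 hM.ad_compat 1 δ ≠ ⊥ →
          ∃ ξ : OneDimAutRepH L, MemXiFamily P (transpose_map_cmConjRingHom_eq_of_frame L ι H T hT) (isUnit_det_of_frame L ι H T hT) μω hμu ξ ∧
            ∀ k : InfinitePlace L → ℤ, μω.HasUnitaryArchType k (fun _ => 0) → ∀ ι' : L →+* ℂ, ξ.IsCohTrivialAt (ArchSignRecipe.tOfArchType k ι') ι') ∧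
    (∃ sgn : OneDimAutRepH L → ℤ, ∀ (P : DiscreteAutomorphicRep (Gp L H) μ),
        IsCot L H ι T hT μ P → KcTrivial L H ι T hT μ P → ∀
        (M : Type) [AddCommGroup M] [Module ℂ M]
        (σK : Representation ℂ (uFormGroup (Fin 2) (Fin 1)).maximalCompact M) (σ𝔤 : (uFormGroup (Fin 2) (Fin 1)).lie →ₗ⁅ℝ⁆ Module.End ℂ M)
        (hM : IsGKModule (uFormGroup (Fin 2) (Fin 1)) σK σ𝔤), IsIrreducibleGK σK σ𝔤 →
        HasToken L H ι T hT μ P M σK σ𝔤 →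
        ∀ δ : ℤ, (δ = 1 ∨ δ = -1) → upqTypeClasses σK σ𝔤 hM.ad_compat 1 δ ≠ ⊥ →
          ∃ ξ : OneDimAutRepH L, MemXiFamily P (transpose_map_cmConjRingHom_eq_of_frame L ι H T hT) (isUnit_det_of_frame L ι H T hT) μω hμu ξ ∧ δ = sgn ξ ∧
            ∀ k : InfinitePlace L → ℤ, μω.HasUnitaryArchType k (fun _ => 0) → ∀ ι' : L →+* ℂ, ξ.IsCohTrivialAt (ArchSignRecipe.tOfArchType k ι') ι') := by
  -- the common core: a token routes `P` to `ξ` off some `S₁`; the coefficient reading at `S := S₁ ∪ ram ξ ∪ ramCls (cl P) ∪ S₀` (v8: the level guard joins) bounds and locates `P`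
  have core : ∀ (P : DiscreteAutomorphicRep (Gp L H) μ), IsCot L H ι T hT μ P → KcTrivial L H ι T hT μ P → ∀ (M : Type) [AddCommGroup M] [Module ℂ M]
      (σK : Representation ℂ (uFormGroup (Fin 2) (Fin 1)).maximalCompact M) (σ𝔤 : (uFormGroup (Fin 2) (Fin 1)).lie →ₗ⁅ℝ⁆ Module.End ℂ M)
      (hM : IsGKModule (uFormGroup (Fin 2) (Fin 1)) σK σ𝔤) (hirr : IsIrreducibleGK σK σ𝔤), HasToken L H ι T hT μ P M σK σ𝔤 →
      ∀ δ : ℤ, (δ = 1 ∨ δ = -1) → upqTypeClasses σK σ𝔤 hM.ad_compat 1 δ ≠ ⊥ →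
        ∃ ξ : OneDimAutRepH L, 𝔠.mult (𝔠.cl P) ≤ 1 ∧ 𝔠.clInf (𝔠.cl P) ∈ (𝔠.packInf ξ).members ∧ 𝔠.cptXi ξ ∧
          (∀ v : Places L, 𝔠.clFin (𝔠.cl P) v ∈ (𝔠.packFin ξ v).members) := by
    intro P hP hKc M _ _ σK σ𝔤 hM hirr htok δ hδ hne'
    obtain ⟨ξ, S₁, hξ⟩ := hl.routing P hP hKc M σK σ𝔤 hM hirr htok δ hδ hne'
    -- v6 (hunk A): the exact ramification set of `cl P` is finite by the guarded pin (x) — the ONLY finiteness the engine uses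
    have hfinR : (𝔠.ramCls (𝔠.cl P)).Finite := hpin.2.2.2.2.2.2.2.2.2 P hP hKc
    set S : Finset (Places L) := S₁ ∪ 𝔠.ram ξ ∪ hfinR.toFinset ∪ S₀ with hSdef
    have hS₀ : S₀ ⊆ S := Finset.subset_union_right
    have hS₁ : S₁ ⊆ S := (Finset.subset_union_left.trans Finset.subset_union_left).trans Finset.subset_union_left
    have hS : 𝔠.ram ξ ⊆ S := (Finset.subset_union_right.trans Finset.subset_union_left).trans Finset.subset_union_left
    have hr : 𝔠.Adm S (𝔠.cl P) :=
      ⟨fun v hv => Finset.mem_coe.2 (Finset.mem_union_left _ (Finset.mem_union_right _ (hfinR.mem_toFinset.2 hv))), hpin.2.2.2.2.2.2.2.2.1 P hKc⟩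
    have hξS : EqOff L H S (𝔠.evp (𝔠.cl P)) (𝔠.tXi ξ) := EqOff.mono L H hS₁ hξ
    have hm1 : (1 : ℕ∞) ≤ ((𝔠.mult (𝔠.cl P) : ℕ) : ℕ∞) := by rw [hpin.1 P]; exact one_le_multiplicity L H μ P
    have hm1' : 1 ≤ 𝔠.mult (𝔠.cl P) := by exact_mod_cast hm1
    obtain ⟨hle, hmem⟩ := 𝔠.mult_le_one_of_formula hl.localExpansion hZ10 ξ S hS₀ hS (𝔠.cl P) hξS hr hm1'
    have hm0 : 𝔠.mult (𝔠.cl P) ≠ 0 := by omega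
    obtain ⟨hinf, hcpt, hfin⟩ := hmem hm0
    refine ⟨ξ, hle, hinf, hcpt, fun v => ?_⟩
    by_cases hv : v ∈ S
    · exact hfin ⟨v, hv⟩
    · have hv1 : v ∉ 𝔠.ram ξ := fun h => hv (hS h)
      have hv2 : v ∉ 𝔠.ramCls (𝔠.cl P) := fun h => hv (Finset.mem_coe.1 (hr.1 h))
      rw [𝔠.unramMember_of_pins hpin hl.xiUnram ξ (𝔠.cl P) v hv1 hv2 (hξS v hv)]
      exact LocalAPacket.πn_mem_members _
  -- membership in the ξ-local family from coordinates in the packets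
  have memb : ∀ (P : DiscreteAutomorphicRep (Gp L H) μ), IsCot L H ι T hT μ P → KcTrivial L H ι T hT μ P → ∀ (ξ : OneDimAutRepH L),
      (∀ v : Places L, 𝔠.clFin (𝔠.cl P) v ∈ (𝔠.packFin ξ v).members) →
      MemXiFamily P (transpose_map_cmConjRingHom_eq_of_frame L ι H T hT) (isUnit_det_of_frame L ι H T hT) μω hμu ξ := by
    intro P hP hKc ξ hfin
    refine ⟨𝔠.packFin ξ, hl.xiFamilyFin ξ, fun v c' hc' => ?_⟩
    rw [hl.localIsotypyFin P hP hKc v c' hc']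
    exact hfin v
  -- the archimedean pin at every complex embedding: at `ι′` over `ι` by `ArchMember` (through `TokenInf`), elsewhere by the compact factor `cptXi` (`CptXiSpec`)
  have arch : ∀ (P : DiscreteAutomorphicRep (Gp L H) μ) (hP : IsCot L H ι T hT μ P) (M : Type) [AddCommGroup M] [Module ℂ M]
      (σK : Representation ℂ (uFormGroup (Fin 2) (Fin 1)).maximalCompact M) (σ𝔤 : (uFormGroup (Fin 2) (Fin 1)).lie →ₗ⁅ℝ⁆ Module.End ℂ M)
      (hM : IsGKModule (uFormGroup (Fin 2) (Fin 1)) σK σ𝔤) (hirr : IsIrreducibleGK σK σ𝔤), HasToken L H ι T hT μ P M σK σ𝔤 →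
      ∀ δ : ℤ, (δ = 1 ∨ δ = -1) → upqTypeClasses σK σ𝔤 hM.ad_compat 1 δ ≠ ⊥ → ∀ ξ : OneDimAutRepH L,
        𝔠.clInf (𝔠.cl P) ∈ (𝔠.packInf ξ).members → 𝔠.cptXi ξ →
        δ = 𝔠.sgnInf ξ ∧ ∀ k : InfinitePlace L → ℤ, μω.HasUnitaryArchType k (fun _ => 0) → ∀ ι' : L →+* ℂ, ξ.IsCohTrivialAt (ArchSignRecipe.tOfArchType k ι') ι' := by
    intro P hP M _ _ σK σ𝔤 hM hirr htok δ hδ hne' ξ hinf hcpt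
    rw [hl.tokenInf P hP M σK σ𝔤 hM hirr htok] at hinf
    refine ⟨hl.archPacketCoh ξ M σK σ𝔤 hM hirr hinf δ hδ hne', fun k hk ι' => ?_⟩
    by_cases hι' : InfinitePlace.mk ι' = InfinitePlace.mk ι
    · exact hl.archMember ξ k hk M σK σ𝔤 hM hirr hinf δ hδ hne' ι' hι'
    · exact hl.cptXiSpec ξ hcpt k hk ι' hι'
  refine ⟨?_, ?_, ⟨𝔠.sgnInf, ?_⟩⟩
  · intro P hP hKc M _ _ σK σ𝔤 hM hirr htok δ hδ hne'
    obtain ⟨ξ, hle, -, -, -⟩ := core P hP hKc M σK σ𝔤 hM hirr htok δ hδ hne'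
    rw [← hpin.1 P]
    exact_mod_cast hle
  · intro P hP hKc M _ _ σK σ𝔤 hM hirr htok δ hδ hne'
    obtain ⟨ξ, -, hinf, hcpt, hfin⟩ := core P hP hKc M σK σ𝔤 hM hirr htok δ hδ hne'
    exact ⟨ξ, memb P hP hKc ξ hfin, (arch P hP M σK σ𝔤 hM hirr htok δ hδ hne' ξ hinf hcpt).2⟩
  · intro P hP hKc M _ _ σK σ𝔤 hM hirr htok δ hδ hne'
    obtain ⟨ξ, -, hinf, hcpt, hfin⟩ := core P hP hKc M σK σ𝔤 hM hirr htok δ hδ hne'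
    exact ⟨ξ, memb P hP hKc ξ hfin, arch P hP M σK σ𝔤 hM hirr htok δ hδ hne' ξ hinf hcpt⟩

/-! ## §5 THE COMPOSITION over the stubs at a NAMED KIT FAMILY, in the letters' frame shape — and the ★ consumers BY NAME -/

/-- **A KIT FAMILY** (v5 = ★ p819986's header VERBATIM; REF1 (g5) OBJ-4): one classification kit per LETTERS' FRAME — a CM field `L` with `[L⁺:ℚ] ≥ 2` (`h2`),
a hermitian `H` of signature `(2,1)` at `ι` (`hT`) and DEFINITE at every other real place (`hdef`), an automorphic measure `μ`, and Rogawski's auxiliary `μω`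
UNITARY with `μω|_{𝕀_{L⁺}} = ω_{L/L⁺}` (`hμω`, §4.8 p. 51) — exactly the binders of ★ `cohDiscrete_memXiFamily` and of the head's conclusion.  (v4 asked for a kit at
every unitary `μω`: review p819638 ∕ OBJ-4 — at a wrong-`μω` frame `Routing` is false for the genuine model, so the family predicates below were unsatisfiable.)
The NAMED kit `𝔠₀` of ED. 4 is such a family whose pinned fields are ★ defs and whose posited fields are explicit parameters (REF1 R-5 (c): never `∃ kit`);
ROAD (i) (R-18): the closer defines `𝔎₀ L ι H T hT hdef h2 μ μω hμu hμω := 𝔠₀ …` and may USE `hdef h2 hμω` in the construction.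
[cite: Rogawski1990, §4.8 p. 51; §14.6 Thm. 14.6.4] -/
def KitFamily : Type 1 :=
  ∀ (L : Type) [Field L] [NumberField L] [IsCMField L] (ι : L →+* ℂ) (H : Matrix (Fin 3) (Fin 3) L) (T : GL (Fin 3) ℂ)
    (hT : (T : Matrix (Fin 3) (Fin 3) ℂ)ᴴ * H.map ι * (T : Matrix (Fin 3) (Fin 3) ℂ) = Literature.Geometry.ComplexHyperbolic.BallModel.J),
    (∀ τ' : L →+* ℂ, InfinitePlace.mk τ' ≠ InfinitePlace.mk ι → (H.map τ').PosDef) →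
    2 ≤ Module.finrank ℚ ↥(maximalRealSubfield L) →
    ∀ (μ : Measure (adelicGroupData (↥(maximalRealSubfield L)) L (IsCMField.complexConj L) 3 H).automorphicQuotient)
    [(adelicGroupData (↥(maximalRealSubfield L)) L (IsCMField.complexConj L) 3 H).IsAutomorphicMeasure μ]
    (μω : HeckeCharacter L) (hμu : μω.IsUnitary),
    (∀ x : Literature.NumberTheory.GaloisRepresentations.ideleGroup ↥(maximalRealSubfield L),
      μω (AdeleRing.ideleBaseChange (↥(maximalRealSubfield L)) L x) = quadraticHeckeCharCM L x) → ClassificationKit L H ι T hT μ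

/-- The family is PINNED at every letters' frame (v5: `hdef`, `h2`, `hμω` threaded — ★ p819986's header VERBATIM). [cite: Rogawski1990, §14.6 Thm. 14.6.4] -/
def KitFamily.IsPinned (𝔎 : KitFamily) : Prop :=
  ∀ (L : Type) [Field L] [NumberField L] [IsCMField L] (ι : L →+* ℂ) (H : Matrix (Fin 3) (Fin 3) L) (T : GL (Fin 3) ℂ)
    (hT : (T : Matrix (Fin 3) (Fin 3) ℂ)ᴴ * H.map ι * (T : Matrix (Fin 3) (Fin 3) ℂ) = Literature.Geometry.ComplexHyperbolic.BallModel.J),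
    ∀ (hdef : ∀ τ' : L →+* ℂ, InfinitePlace.mk τ' ≠ InfinitePlace.mk ι → (H.map τ').PosDef)
    (h2 : 2 ≤ Module.finrank ℚ ↥(maximalRealSubfield L))
    (μ : Measure (adelicGroupData (↥(maximalRealSubfield L)) L (IsCMField.complexConj L) 3 H).automorphicQuotient)
    [(adelicGroupData (↥(maximalRealSubfield L)) L (IsCMField.complexConj L) 3 H).IsAutomorphicMeasure μ]
    (μω : HeckeCharacter L) (hμu : μω.IsUnitary),
    ∀ (hμω : ∀ x : Literature.NumberTheory.GaloisRepresentations.ideleGroup ↥(maximalRealSubfield L),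
      μω (AdeleRing.ideleBaseChange (↥(maximalRealSubfield L)) L x) = quadraticHeckeCharCM L x), (𝔎 L ι H T hT hdef h2 μ μω hμu hμω).IsPinned

/-- The family satisfies the LAWS at every letters' frame (v5: `hdef`, `h2`, `hμω` threaded — ★ p819986's header VERBATIM; at ED. 4: one open instance per law at `𝔠₀`),
for SOME level guard `S₀` of the frame (v8, RULING (V44): the closer unions the bad sets of its letters).
[cite: Rogawski1990, §14.6 Thm. 14.6.4; §14.2 p. 228 l. 1] -/
def KitFamily.Laws (𝔎 : KitFamily) : Prop :=
  ∀ (L : Type) [Field L] [NumberField L] [IsCMField L] (ι : L →+* ℂ) (H : Matrix (Fin 3) (Fin 3) L) (T : GL (Fin 3) ℂ)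
    (hT : (T : Matrix (Fin 3) (Fin 3) ℂ)ᴴ * H.map ι * (T : Matrix (Fin 3) (Fin 3) ℂ) = Literature.Geometry.ComplexHyperbolic.BallModel.J),
    ∀ (hdef : ∀ τ' : L →+* ℂ, InfinitePlace.mk τ' ≠ InfinitePlace.mk ι → (H.map τ').PosDef)
    (h2 : 2 ≤ Module.finrank ℚ ↥(maximalRealSubfield L))
    (μ : Measure (adelicGroupData (↥(maximalRealSubfield L)) L (IsCMField.complexConj L) 3 H).automorphicQuotient)
    [(adelicGroupData (↥(maximalRealSubfield L)) L (IsCMField.complexConj L) 3 H).IsAutomorphicMeasure μ]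
    (μω : HeckeCharacter L) (hμu : μω.IsUnitary),
    ∀ (hμω : ∀ x : Literature.NumberTheory.GaloisRepresentations.ideleGroup ↥(maximalRealSubfield L),
      μω (AdeleRing.ideleBaseChange (↥(maximalRealSubfield L)) L x) = quadraticHeckeCharCM L x),
      ∃ S₀ : Finset (Places L), (𝔎 L ι H T hT hdef h2 μ μω hμu hμω).Laws μω hμu S₀

/-- **`shapeGuarded_of_T5`** (v4 statement; v5 proof threads `hdef h2 hμω` into the family): a NAMED pinned kit family with the laws ⇒ `∀ compact CM frame, (C1♮) ∧ (C2♯) ∧ (C3♯)` for COTANGENT-TYPE, `Kc`-TRIVIAL `P`, spelled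
LITERALLY (no kit, no abbreviation of this file) — the shape the ★ consumers take in ED. 2: p04 (g6) B0 `letters_guarded_of_shape` (threads the cotangent guard `hP`,
derives `Kc`-triviality from p02 (g6) `F0P3CompactTrivOfRecord`), F0P2's S2♯ (reads the archimedean pin into ★ `XiArchPinned L ξ μω k` with its own `k`).
[cite: Rogawski1990, §14.6 Thm. 14.6.4; Prop. 15.2.1] -/
theorem shapeGuarded_of_T5 (𝔎 : KitFamily) (hpin : KitFamily.IsPinned 𝔎) (hlaws : 𝔎.Laws) :
    ∀ (L : Type) [Field L] [NumberField L] [IsCMField L] (ι : L →+* ℂ) (H : Matrix (Fin 3) (Fin 3) L) (T : GL (Fin 3) ℂ)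
      (hT : (T : Matrix (Fin 3) (Fin 3) ℂ)ᴴ * H.map ι * (T : Matrix (Fin 3) (Fin 3) ℂ) = Literature.Geometry.ComplexHyperbolic.BallModel.J),
      (∀ τ' : L →+* ℂ, InfinitePlace.mk τ' ≠ InfinitePlace.mk ι → (H.map τ').PosDef) →
      2 ≤ Module.finrank ℚ ↥(maximalRealSubfield L) →
      ∀ (μ : Measure (adelicGroupData (↥(maximalRealSubfield L)) L (IsCMField.complexConj L) 3 H).automorphicQuotient)
        [(adelicGroupData (↥(maximalRealSubfield L)) L (IsCMField.complexConj L) 3 H).IsAutomorphicMeasure μ]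
        (μω : HeckeCharacter L) (hμu : μω.IsUnitary),
        (∀ x : Literature.NumberTheory.GaloisRepresentations.ideleGroup ↥(maximalRealSubfield L),
          μω (AdeleRing.ideleBaseChange (↥(maximalRealSubfield L)) L x) = quadraticHeckeCharCM L x) →
      (∀ (P : DiscreteAutomorphicRep (adelicGroupData (↥(maximalRealSubfield L)) L (IsCMField.complexConj L) 3 H) μ),
          (P.IsHolCotangentAt (cmArchSection L ι H T hT) (cmCompactFactor L ι H T hT) ∨
            P.IsAntiholCotangentAt (cmArchSection L ι H T hT) (cmCompactFactor L ι H T hT)) →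
          (∀ k : (adelicGroupData (↥(maximalRealSubfield L)) L (IsCMField.complexConj L) 3 H).Adelic, k ∈ cmCompactFactor L ι H T hT → ∀ v : P.space.toSubmodule, (adelicGroupData (↥(maximalRealSubfield L)) L (IsCMField.complexConj L) 3 H).rightRegular μ k (v : (adelicGroupData (↥(maximalRealSubfield L)) L (IsCMField.complexConj L) 3 H).L2 μ) = v) → ∀
          (M : Type) [AddCommGroup M] [Module ℂ M]
          (σK : Representation ℂ (uFormGroup (Fin 2) (Fin 1)).maximalCompact M) (σ𝔤 : (uFormGroup (Fin 2) (Fin 1)).lie →ₗ⁅ℝ⁆ Module.End ℂ M)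
          (hM : IsGKModule (uFormGroup (Fin 2) (Fin 1)) σK σ𝔤), IsIrreducibleGK σK σ𝔤 →
          (∃ T₁ : P.archModuleCM ι T hT →ₗ[ℂ] M,
            (∀ (k : (uFormGroup (Fin 2) (Fin 1)).maximalCompact) (w : P.archModuleCM ι T hT), T₁ (P.archRepKCM ι T hT k w) = σK k (T₁ w)) ∧
              (∀ (X : (uFormGroup (Fin 2) (Fin 1)).lie) (w : P.archModuleCM ι T hT), T₁ (P.archRepLieCM ι T hT X w) = σ𝔤 X (T₁ w)) ∧ T₁ ≠ 0) →
          ∀ δ : ℤ, (δ = 1 ∨ δ = -1) → upqTypeClasses σK σ𝔤 hM.ad_compat 1 δ ≠ ⊥ →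
            ((adelicGroupData (↥(maximalRealSubfield L)) L (IsCMField.complexConj L) 3 H).rightRegular μ).multiplicity P.space.toContRep ≤ 1) ∧
      (∀ (P : DiscreteAutomorphicRep (adelicGroupData (↥(maximalRealSubfield L)) L (IsCMField.complexConj L) 3 H) μ),
          (P.IsHolCotangentAt (cmArchSection L ι H T hT) (cmCompactFactor L ι H T hT) ∨
            P.IsAntiholCotangentAt (cmArchSection L ι H T hT) (cmCompactFactor L ι H T hT)) →
          (∀ k : (adelicGroupData (↥(maximalRealSubfield L)) L (IsCMField.complexConj L) 3 H).Adelic, k ∈ cmCompactFactor L ι H T hT → ∀ v : P.space.toSubmodule, (adelicGroupData (↥(maximalRealSubfield L)) L (IsCMField.complexConj L) 3 H).rightRegular μ k (v : (adelicGroupData (↥(maximalRealSubfield L)) L (IsCMField.complexConj L) 3 H).L2 μ) = v) → ∀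
          (M : Type) [AddCommGroup M] [Module ℂ M]
          (σK : Representation ℂ (uFormGroup (Fin 2) (Fin 1)).maximalCompact M) (σ𝔤 : (uFormGroup (Fin 2) (Fin 1)).lie →ₗ⁅ℝ⁆ Module.End ℂ M)
          (hM : IsGKModule (uFormGroup (Fin 2) (Fin 1)) σK σ𝔤), IsIrreducibleGK σK σ𝔤 →
          (∃ T₁ : P.archModuleCM ι T hT →ₗ[ℂ] M,
            (∀ (k : (uFormGroup (Fin 2) (Fin 1)).maximalCompact) (w : P.archModuleCM ι T hT), T₁ (P.archRepKCM ι T hT k w) = σK k (T₁ w)) ∧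
              (∀ (X : (uFormGroup (Fin 2) (Fin 1)).lie) (w : P.archModuleCM ι T hT), T₁ (P.archRepLieCM ι T hT X w) = σ𝔤 X (T₁ w)) ∧ T₁ ≠ 0) →
          ∀ δ : ℤ, (δ = 1 ∨ δ = -1) → upqTypeClasses σK σ𝔤 hM.ad_compat 1 δ ≠ ⊥ →
            ∃ ξ : OneDimAutRepH L, MemXiFamily P (transpose_map_cmConjRingHom_eq_of_frame L ι H T hT) (isUnit_det_of_frame L ι H T hT) μω hμu ξ ∧
              ∀ k : InfinitePlace L → ℤ, μω.HasUnitaryArchType k (fun _ => 0) → ∀ ι' : L →+* ℂ, ξ.IsCohTrivialAt (ArchSignRecipe.tOfArchType k ι') ι') ∧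
      (∃ sgn : OneDimAutRepH L → ℤ, ∀ (P : DiscreteAutomorphicRep (adelicGroupData (↥(maximalRealSubfield L)) L (IsCMField.complexConj L) 3 H) μ),
          (P.IsHolCotangentAt (cmArchSection L ι H T hT) (cmCompactFactor L ι H T hT) ∨
            P.IsAntiholCotangentAt (cmArchSection L ι H T hT) (cmCompactFactor L ι H T hT)) →
          (∀ k : (adelicGroupData (↥(maximalRealSubfield L)) L (IsCMField.complexConj L) 3 H).Adelic, k ∈ cmCompactFactor L ι H T hT → ∀ v : P.space.toSubmodule, (adelicGroupData (↥(maximalRealSubfield L)) L (IsCMField.complexConj L) 3 H).rightRegular μ k (v : (adelicGroupData (↥(maximalRealSubfield L)) L (IsCMField.complexConj L) 3 H).L2 μ) = v) → ∀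
          (M : Type) [AddCommGroup M] [Module ℂ M]
          (σK : Representation ℂ (uFormGroup (Fin 2) (Fin 1)).maximalCompact M) (σ𝔤 : (uFormGroup (Fin 2) (Fin 1)).lie →ₗ⁅ℝ⁆ Module.End ℂ M)
          (hM : IsGKModule (uFormGroup (Fin 2) (Fin 1)) σK σ𝔤), IsIrreducibleGK σK σ𝔤 →
          (∃ T₁ : P.archModuleCM ι T hT →ₗ[ℂ] M,
            (∀ (k : (uFormGroup (Fin 2) (Fin 1)).maximalCompact) (w : P.archModuleCM ι T hT), T₁ (P.archRepKCM ι T hT k w) = σK k (T₁ w)) ∧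
              (∀ (X : (uFormGroup (Fin 2) (Fin 1)).lie) (w : P.archModuleCM ι T hT), T₁ (P.archRepLieCM ι T hT X w) = σ𝔤 X (T₁ w)) ∧ T₁ ≠ 0) →
          ∀ δ : ℤ, (δ = 1 ∨ δ = -1) → upqTypeClasses σK σ𝔤 hM.ad_compat 1 δ ≠ ⊥ →
            ∃ ξ : OneDimAutRepH L, MemXiFamily P (transpose_map_cmConjRingHom_eq_of_frame L ι H T hT) (isUnit_det_of_frame L ι H T hT) μω hμu ξ ∧ δ = sgn ξ ∧
              ∀ k : InfinitePlace L → ℤ, μω.HasUnitaryArchType k (fun _ => 0) → ∀ ι' : L →+* ℂ, ξ.IsCohTrivialAt (ArchSignRecipe.tOfArchType k ι') ι') := by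
  intro L _ _ _ ι H T hT hdef h2 μ _ μω hμu hμω
  have hp := hpin L ι H T hT hdef h2 μ μω hμu hμω
  -- Theorems edition: `Exists.elim` instead of the Lines text's `obtain ⟨S₀, hl⟩ := …` (same proof term; elaborates at DEFAULT heartbeats)
  exact (hlaws L ι H T hT hdef h2 μ μω hμu hμω).elim fun S₀ hl =>
    shape_of_T5 H ι T hT μ μω hμu (𝔎 L ι H T hT hdef h2 μ μω hμu hμω) hp hl
    (ClassificationKit.coefficientFormula_of_laws_grouped _
      (perClassIdentity_of_laws _ hl.traceIdentity hl.spectralSideGp hl.factorisation hl.matchingS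
        (separation_of_laws _ (hatInjective_of_pins _ hp hl.evpConvention) hl.hatBounded hl.unrStarAlgebra) hl.unrStarAlgebra)
      hl.transferS hl.linIndepS hl.unitaryCoord hl.unitaryPacket hl.aPacketSpectral hl.localExpansion)

end Summit.HodgeConjecture.HodgeConjecture.Cruxes.H413.F0P3InnerFormClassificationV8
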